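import Summits.QuantumFields.YangMills.Theorems.LuscherReductionTwistedTraceScalingBOCurrencyFloor
import Summits.QuantumFields.YangMills.Theorems.LuscherReductionTwistedTraceScalingBODefectRates
import HarnessLib

/-!
# (B-ST) step (B), the currency of the tails: the LINEAR absolute floor `c_Λ·β^{-K}·(e^{2β})^{|E|} ≤ Λ(β)` of the record constant, and the tail budget `(e^{2β})^{|E|}·P·e^{−qℓ²} ≤ a·Λ(β)`
# (lane A of S-BASE, crux `TwistedTraceScaling` stmt-QuantumFields-20203, C4-CORE, the (B-ST) pen; design card `pub/ym-fleet/ym-luscher-20007-p1/Lines-BST-poincare.md` (B); HANDOFF-g21 (S6))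

The two tail doors of the (B-ST) pen (`…BOStiffTailShell.qform_basedAvg_le_of_action_ge` — magnetic shell — and `…BOStiffTailFP.l2_basedAvg_indicator_le` + `qform_le_sup_mul_l2` — gauge-far)
bound the transfer form of the based average of a tail piece ABSOLUTELY by `(e^{2β})^{|E|}·X(β)·‖f‖²_w` with `X(β) = P·e^{−qℓ²}`, `ℓ = btLog β`.  The (B-ST) target `hST` is stated in
the currency `Λ(β) = (btC/fpZ/γ)·λ₀(L³β)` of `…BORecordInputOfST.recordAnalyticInput_of_hST`.  This file converts, with NO test function involved (compare the quadratic floor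
`…BOCurrencyFloor.currency_floor` of the (OD) pen, which carries `T(φ)`):
* ★ `recordLambda_floor` — `∃ c_Λ > 0, K, ∀ᶠ β, c_Λ·(β^{-1})^K·(e^{2β})^{|E|} ≤ Λ(β)`: `btC ≥ C₁β^{-K₁}` (`…BOBtCPolyFloor.btC_record_poly_floor`), `fpZ ≤ 1`, `γ ≤ N̄(1)·π(univ)`
  (`recordGamma_le_fpWeightBar_one`), `λ₀(B) ≥ e^{6B}e^{−3}B^{−9/2}/2000 ≥ e^{6B}e^{−3}B^{−5}/2000` (`…BTTopValue.levelValue_one_site_zero_ge`, `B = L³β ≥ 1`, `e^{6B} = (e^{2β})^{|E|}`);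
* ★★ `eventually_tail_budget_le` — for `q > 0`, `P ≥ 0` and every `a > 0`: `∀ᶠ β, (e^{2β})^{|E|}·(P·e^{−q·btLog β²}) ≤ a·Λ(β)` (super-polynomial decay beats the polynomial floor:
  `…BTRatesBudget.eventually_exp_logsq_le`).
So each tail contributes `≤ a·Λ·‖v‖²_w` to the stability bound, for any prescribed `a > 0`, eventually in `β` (next files: `…BOStiffTailShellRecord`, `…BOStiffTailFarRecord`).
HONEST FRAMING: bookkeeping for a stub of a child of the CONDITIONAL route R2b1; (B-ST) OPEN; C4-CORE OPEN; not infinite volume, not a gap, not Clay.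
-/

set_option autoImplicit false

noncomputable section

open MeasureTheory Filter Topology Real
open scoped BigOperators
open Literature.MathematicalPhysics.QuantumFieldTheory
open Literature.MathematicalPhysics.QuantumLattice

namespace Summit.QuantumFields.YangMills.Theorems.FemtoTransferGap.TwoLattice.ConstTube

open Summit.QuantumFields.YangMills.Theorems.FemtoTransferGap
open Summit.QuantumFields.YangMills.Theorems.FemtoTransferGap.TwoLattice
open Summit.QuantumFields.YangMills.Theorems.FemtoTransferGap.TwoLattice.Avg
open Summit.QuantumFields.YangMills.Theorems.FemtoTransferGap.TwoLattice.Stiff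
open Summit.QuantumFields.YangMills.Theorems.FemtoTransferGap.TwoLattice.GnChart
open Summit.QuantumFields.YangMills.Theorems.FemtoTransferGap.TwoLattice.Cov

variable {L : ℕ} [NeZero L]

/-- Pure algebra of the linear floor: a product of four nonnegative lower bounds. [folklore] -/
theorem recordLambda_floor_alg {btC C₁K lam lamF Z γ G : ℝ} (hC₁K : 0 ≤ C₁K) (hbtC : C₁K ≤ btC) (hlamF : 0 ≤ lamF) (hlam : lamF ≤ lam)
    (hZ0 : 0 < Z) (hZ1 : Z ≤ 1) (hγ0 : 0 < γ) (hγG : γ ≤ G) :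
    C₁K * lamF / G ≤ btC / Z / γ * lam := by
  have hG0 : 0 < G := lt_of_lt_of_le hγ0 hγG
  have hbtC0 : 0 ≤ btC := hC₁K.trans hbtC
  have h3 : 1 / G ≤ 1 / γ := one_div_le_one_div_of_le hγ0 hγG
  have h4 : (1 : ℝ) ≤ 1 / Z := by rw [le_div_iff₀ hZ0, one_mul]; exact hZ1
  have hlam0 : 0 ≤ lam := hlamF.trans hlam
  have hprod : C₁K * lamF * (1 / G) * 1 ≤ btC * lam * (1 / γ) * (1 / Z) :=
    mul_le_mul (mul_le_mul (mul_le_mul hbtC hlam hlamF hbtC0) h3 (one_div_pos.mpr hG0).le (mul_nonneg hbtC0 hlam0)) h4 zero_le_one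
      (mul_nonneg (mul_nonneg hbtC0 hlam0) (one_div_pos.mpr hγ0).le)
  calc C₁K * lamF / G = C₁K * lamF * (1 / G) * 1 := by ring
    _ ≤ btC * lam * (1 / γ) * (1 / Z) := hprod
    _ = btC / Z / γ * lam := by field_simp

/-- For `B ≥ 1`: `B^{-5} ≤ B^{-9/2}`. [folklore] -/
theorem rpow_neg_nine_halves_ge {B : ℝ} (hB1 : 1 ≤ B) : (B ^ 5)⁻¹ ≤ B ^ (-(9 : ℝ) / 2) := by
  have hB0 : 0 < B := by linarith
  have e : (B ^ 5)⁻¹ = B ^ (-(5 : ℝ)) := by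
    rw [Real.rpow_neg hB0.le, ← Real.rpow_natCast]; norm_num
  rw [e]
  exact Real.rpow_le_rpow_of_exponent_le hB1 (by norm_num)

set_option maxHeartbeats 800000 in
-- long record expressions.
/-- ★ **THE LINEAR ABSOLUTE FLOOR OF THE RECORD CURRENCY**: `∃ c_Λ > 0, K, ∀ᶠ β, c_Λ·(β^{-1})^K·(e^{2β})^{|E|} ≤ Λ(β)`,
`Λ(β) = (btC L β Ω_c (btEps β) (5β^{-1/2}ℓ²) / fpZ (btEps β) / γ(β))·λ₀(L³β)` (the currency of `hST`). [cite: Luscher1983, §3] -/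
theorem recordLambda_floor :
    ∃ (cΛ : ℝ) (K : ℕ), 0 < cΛ ∧ ∀ᶠ β : ℝ in atTop,
      cΛ * powScale 1 β ^ K * Real.exp (2 * β) ^ Fintype.card (Edge 3 L) ≤
        btC L β (fun x : LinkSpace L => {x : LinkSpace L | linkCurry x ∈ capBalancedSet L}.indicator (fun _ => (1 : ℝ)) x * frozenProfile L (fun β' => stiffGaussExp L (β' / 2) β') (fun β' => min (1 / 40) (powScale (1 / 2) β' * btLog β')) β x) (btEps β) (5 * (powScale (1 / 2) β * btLog β ^ 2)) / fpZ (btEps β) / recordGamma L (fun β' => fun x : LinkSpace L => {x : LinkSpace L | linkCurry x ∈ capBalancedSet L}.indicator (fun _ => (1 : ℝ)) x * frozenProfile L (fun β'' => stiffGaussExp L (β'' / 2) β'') (fun β'' => min (1 / 40) (powScale (1 / 2) β'' * btLog β'')) β' x) β *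
          levelValue su2Rep 1 ((L : ℝ) ^ 3 * β) 0 := by
  haveI := isFiniteMeasure_orthoTransverse L
  obtain ⟨C₁, K₁, hC₁, hbtC⟩ := btC_record_poly_floor (L := L)
  set G : ℝ := fpWeightBar L 1 * (orthoTransverse L).real Set.univ + 1 with hGdef
  have hG0 : 0 < G := by
    have : 0 ≤ fpWeightBar L 1 * (orthoTransverse L).real Set.univ := mul_nonneg (fpWeightBar_pos L one_pos).le measureReal_nonneg
    rw [hGdef]; linarith
  have hL1 : (1 : ℝ) ≤ L := by exact_mod_cast NeZero.one_le
  have hL3 : (1 : ℝ) ≤ (L : ℝ) ^ 3 := one_le_pow₀ hL1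
  have hL30 : (0 : ℝ) < (L : ℝ) ^ 3 := by positivity
  refine ⟨C₁ * (Real.exp (-3) / 2000) / ((L : ℝ) ^ 3) ^ 5 / G, K₁ + 5, by positivity, ?_⟩
  have hrs := rStar_pos
  filter_upwards [hbtC, eventually_ge_atTop (1 : ℝ), eventually_ge_atTop (2 / rStar ^ 3)] with β hbtCβ hβ1 hβr
  have hβ0 : 0 ≤ β := by linarith
  set B : ℝ := (L : ℝ) ^ 3 * β with hBdef
  have hB1 : 1 ≤ B := by rw [hBdef]; nlinarith
  have hB2 : 2 / rStar ^ 3 ≤ B := by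
    rw [hBdef]; have : 0 ≤ 2 / rStar ^ 3 := by positivity
    nlinarith
  have hB0 : 0 < B := by linarith
  have hlam := levelValue_one_site_zero_ge hB1 hB2
  have hZ0 : 0 < fpZ (btEps β) := fpZ_pos (powScale_pos 1 β)
  have hZ1 : fpZ (btEps β) ≤ 1 := fpZ_le_one (powScale 1 β)
  have hγ0 := recordGamma_record_pos (L := L) hβ0
  have hγG : recordGamma L (fun β' => fun x : LinkSpace L => {x : LinkSpace L | linkCurry x ∈ capBalancedSet L}.indicator (fun _ => (1 : ℝ)) x * frozenProfile L (fun β'' => stiffGaussExp L (β'' / 2) β'') (fun β'' => min (1 / 40) (powScale (1 / 2) β'' * btLog β'')) β' x) β ≤ G := by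
    have := recordGamma_le_fpWeightBar_one (L := L) β; rw [hGdef]; linarith
  -- the weaker floor of `λ₀`: `e^{6B}·e^{-3}B^{-5}/2000 ≤ e^{6B}·e^{-3}B^{-9/2}/2000 ≤ λ₀`
  have hlamF0 : 0 ≤ Real.exp (6 * B) * (Real.exp (-3) * (B ^ 5)⁻¹ / 2000) := by positivity
  have hlamF : Real.exp (6 * B) * (Real.exp (-3) * (B ^ 5)⁻¹ / 2000) ≤ levelValue su2Rep 1 B 0 := by
    refine le_trans (mul_le_mul_of_nonneg_left ?_ (Real.exp_pos _).le) hlam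
    exact div_le_div_of_nonneg_right (mul_le_mul_of_nonneg_left (rpow_neg_nine_halves_ge hB1) (Real.exp_pos _).le) (by norm_num)
  have hC₁K : 0 ≤ C₁ * powScale 1 β ^ K₁ := mul_nonneg hC₁.le (pow_nonneg (powScale_pos 1 β).le _)
  have hbtCβ' : C₁ * powScale 1 β ^ K₁ ≤ btC L β (fun x : LinkSpace L => {x : LinkSpace L | linkCurry x ∈ capBalancedSet L}.indicator (fun _ => (1 : ℝ)) x * frozenProfile L (fun β' => stiffGaussExp L (β' / 2) β') (fun β' => min (1 / 40) (powScale (1 / 2) β' * btLog β')) β x) (btEps β) (5 * (powScale (1 / 2) β * btLog β ^ 2)) := hbtCβ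
  have key := recordLambda_floor_alg hC₁K hbtCβ' hlamF0 hlamF hZ0 hZ1 hγ0 hγG
  -- identify the left-hand side
  have hps1 : powScale 1 β = β⁻¹ := by rw [powScale_eq hβ1, Real.rpow_neg_one]
  have hE : Real.exp (6 * B) = Real.exp (2 * β) ^ Fintype.card (Edge 3 L) := by rw [exp_two_pow_card_edge]
  have hBinv : (B ^ 5)⁻¹ = powScale 1 β ^ 5 / ((L : ℝ) ^ 3) ^ 5 := by
    rw [hps1, hBdef, mul_pow, inv_pow]; field_simp
  have hlhs : C₁ * (Real.exp (-3) / 2000) / ((L : ℝ) ^ 3) ^ 5 / G * powScale 1 β ^ (K₁ + 5) * Real.exp (2 * β) ^ Fintype.card (Edge 3 L) =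
      C₁ * powScale 1 β ^ K₁ * (Real.exp (6 * B) * (Real.exp (-3) * (B ^ 5)⁻¹ / 2000)) / G := by
    rw [hE, hBinv, pow_add]
    field_simp
  rw [hlhs]
  exact key

set_option maxHeartbeats 800000 in
-- long record expressions.
/-- ★★ **THE TAIL BUDGET**: for `q > 0`, `P ≥ 0` and every `a > 0`, eventually `(e^{2β})^{|E|}·(P·e^{−q·btLog β²}) ≤ a·Λ(β)` — a super-polynomially small absolute tail is an
arbitrarily small multiple of the record currency. [cite: Luscher1983, §3] -/
theorem eventually_tail_budget_le {q P : ℝ} (hq : 0 < q) (hP : 0 ≤ P) {a : ℝ} (ha : 0 < a) :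
    ∀ᶠ β : ℝ in atTop,
      Real.exp (2 * β) ^ Fintype.card (Edge 3 L) * (P * Real.exp (-(q * btLog β ^ 2))) ≤
        a * (btC L β (fun x : LinkSpace L => {x : LinkSpace L | linkCurry x ∈ capBalancedSet L}.indicator (fun _ => (1 : ℝ)) x * frozenProfile L (fun β' => stiffGaussExp L (β' / 2) β') (fun β' => min (1 / 40) (powScale (1 / 2) β' * btLog β')) β x) (btEps β) (5 * (powScale (1 / 2) β * btLog β ^ 2)) / fpZ (btEps β) / recordGamma L (fun β' => fun x : LinkSpace L => {x : LinkSpace L | linkCurry x ∈ capBalancedSet L}.indicator (fun _ => (1 : ℝ)) x * frozenProfile L (fun β'' => stiffGaussExp L (β'' / 2) β'') (fun β'' => min (1 / 40) (powScale (1 / 2) β'' * btLog β'')) β' x) β *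
          levelValue su2Rep 1 ((L : ℝ) ^ 3 * β) 0) := by
  obtain ⟨cΛ, K, hcΛ, hfloor⟩ := recordLambda_floor (L := L)
  -- `P·e^{−qℓ²} ≤ e^{log(P+1) − q log²β} ≤ (a·c_Λ)·(β^{-1})^K` eventually
  have hsmall := eventually_exp_logsq_le (K := Real.log (P + 1)) hq (mul_pos ha hcΛ) K
  filter_upwards [hfloor, hsmall, eventually_ge_atTop (1 : ℝ)] with β hΛ hsm hβ1
  have hEK : 0 ≤ Real.exp (2 * β) ^ Fintype.card (Edge 3 L) := by positivity
  have hP1 : P ≤ Real.exp (Real.log (P + 1)) := by rw [Real.exp_log (by linarith)]; linarith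
  have h1 : P * Real.exp (-(q * btLog β ^ 2)) ≤ a * cΛ * powScale 1 β ^ K :=
    calc P * Real.exp (-(q * btLog β ^ 2)) ≤ Real.exp (Real.log (P + 1)) * Real.exp (-(q * Real.log β ^ 2)) :=
          mul_le_mul hP1 (exp_neg_btLog_sq_le hq.le hβ1) (Real.exp_pos _).le (Real.exp_pos _).le
      _ = Real.exp (Real.log (P + 1) - q * Real.log β ^ 2) := by rw [← Real.exp_add]; ring_nf
      _ ≤ a * cΛ * powScale 1 β ^ K := hsm
  calc Real.exp (2 * β) ^ Fintype.card (Edge 3 L) * (P * Real.exp (-(q * btLog β ^ 2)))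
      ≤ Real.exp (2 * β) ^ Fintype.card (Edge 3 L) * (a * cΛ * powScale 1 β ^ K) := mul_le_mul_of_nonneg_left h1 hEK
    _ = a * (cΛ * powScale 1 β ^ K * Real.exp (2 * β) ^ Fintype.card (Edge 3 L)) := by ring
    _ ≤ _ := mul_le_mul_of_nonneg_left hΛ ha.le

end Summit.QuantumFields.YangMills.Theorems.FemtoTransferGap.TwoLattice.ConstTube

end
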